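import Literature.NumberTheory.Transcendental.BakerLogarithmsConclusion

/-!
# `NormalFormPrinciple` (stmt-KontsevichZagierPeriods-3869), line `SketchIdeator1` — the mixed
# Baker endgame `eq_zero_of_alg_logs_angles_eq_zero` (siege attempt k4: certificate / finite core)

Pure proof file (`--supports` the crux stmt-KontsevichZagierPeriods-3869), no definitions. It proves
the registered sub-goal of the arctangent layer of the leaf `stub_boxRigidity`

* `eq_zero_of_alg_logs_angles_eq_zero`: if `ε₁, …, ε_s > 0` are real algebraic numbers with
  `ℚ`-linearly independent logarithms, `θ₁, …, θ_{s'}` are `ℚ`-linearly independent real numbers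
  with every `e^{iθ_k}` algebraic, and `r + Σᵢ Cᵢ log εᵢ + Σ_k D_k θ_k = 0` with real ALGEBRAIC
  `r, Cᵢ, D_k`, then `r = 0`, every `Cᵢ = 0` and every `D_k = 0`

(the values of one-dimensional rational integral representations are `ℚ̄`-combinations of `1`, of
logarithms `log ε` of real algebraic numbers and of angles `θ = arg` of algebraic points of the
unit circle; this is the arithmetic that makes the mixed normal form `pt + dlog + arctan` rigid).

Organisation ("certificate, then decide on the finite core"):

1. `linearIndependent_rat_logs_angles` — the MIXED family of complex logarithms
   `log ε₁, …, log ε_s, iθ₁, …, iθ_{s'}` (indexed by `Fin s ⊕ Fin s'`) is `ℚ`-linearly independent: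
   a rational relation splits into its real part (a relation among the `log εᵢ`) and its imaginary
   part (a relation among the `θ_k`).
2. `linearIndependent_algebraicClosure_one_logs_angles` — the TRANSCENDENCE input enters exactly
   once: Baker's theorem (`Literature.NumberTheory.Transcendental.baker_holds`, Baker 1975,
   Thm. 2.1, proved in the tree) at this mixed family (`e^{log εᵢ} = εᵢ` and `e^{iθ_k}` are
   algebraic). Its output is a CERTIFICATE: `1, log εᵢ, iθ_k ∈ ℂ`, indexed by
   `Option (Fin s ⊕ Fin s')`, are linearly independent over `ℚ̄ = algebraicClosure ℚ ℂ`.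
3. `eq_zero_of_linearIndependent_option_sum_elim` — pure finite-dimensional linear algebra: against
   such a certificate a single finite relation `a • u + Σᵢ cᵢ • vᵢ + Σ_k d_k • w_k = 0` has all
   coefficients zero (`Fintype.linearIndependent_iff`, the sum split by `Fintype.sum_option` and
   `Fintype.sum_sum_type`).
4. The registered statement: read the real relation in `ℂ` as
   `r • 1 + Σᵢ Cᵢ • log εᵢ + Σ_k (-i D_k) • (iθ_k) = 0`, coefficients in `ℚ̄` (`i ∈ ℚ̄`), and apply
   3 to 2.

Sources: A. Baker, *Transcendental Number Theory* (1975), Theorem 2.1; M. Kontsevich, D. Zagier,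
*Periods* (2001), §1.2.
-/

noncomputable section

open Complex (I)

namespace Summit.KontsevichZagierPeriods.HurwitzMicroSectors.NormalFormPrinciple.PiBox.Ang.SiegeK4

/-! ## The finite core -/

/-- **Finite core.** If the finite family `u, v₁, …, vₙ, w₁, …, wₘ` (indexed by `Option (ι ⊕ κ)`,
`none ↦ u`, `some (inl i) ↦ vᵢ`, `some (inr k) ↦ w_k`) is linearly independent over `K`, then a
relation `a • u + Σᵢ cᵢ • vᵢ + Σ_k d_k • w_k = 0` with coefficients in `K` is trivial. [folklore] -/
theorem eq_zero_of_linearIndependent_option_sum_elim {K V ι κ : Type*} [Ring K] [AddCommGroup V]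
    [Module K V] [Fintype ι] [Fintype κ] {u : V} {v : ι → V} {w : κ → V}
    (hli : LinearIndependent K fun o : Option (ι ⊕ κ) => o.elim u (Sum.elim v w))
    (a : K) (c : ι → K) (d : κ → K) (h : a • u + ∑ i, c i • v i + ∑ k, d k • w k = 0) :
    a = 0 ∧ (∀ i, c i = 0) ∧ ∀ k, d k = 0 := by
  have h0 : ∀ o, Option.elim o a (Sum.elim c d) = 0 :=
    Fintype.linearIndependent_iff.mp hli (fun o => o.elim a (Sum.elim c d)) (by
      rw [Fintype.sum_option, Fintype.sum_sum_type]
      simpa only [Option.elim_none, Option.elim_some, Sum.elim_inl, Sum.elim_inr, add_assoc]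
        using h)
  exact ⟨h0 none, fun i => h0 (some (Sum.inl i)), fun k => h0 (some (Sum.inr k))⟩

/-! ## The mixed family of logarithms is `ℚ`-independent -/

/-- **Real and imaginary logarithms do not mix over `ℚ`.** If `log ε₁, …, log ε_s` are
`ℚ`-linearly independent reals and `θ₁, …, θ_{s'}` are `ℚ`-linearly independent reals, then the
complex family `log ε₁, …, log ε_s, iθ₁, …, iθ_{s'}` is `ℚ`-linearly independent (split a relation
into real and imaginary parts). [folklore] -/
theorem linearIndependent_rat_logs_angles {s s' : ℕ} (ε : Fin s → ℝ)
    (hli : LinearIndependent ℚ (fun i => Real.log (ε i))) (θ : Fin s' → ℝ)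
    (hliθ : LinearIndependent ℚ θ) :
    LinearIndependent ℚ (Sum.elim (fun i => ((Real.log (ε i) : ℝ) : ℂ))
      (fun k => (θ k : ℂ) * I)) := by
  rw [Fintype.linearIndependent_iff]
  intro g hg
  rw [Fintype.sum_sum_type] at hg
  simp only [Sum.elim_inl, Sum.elim_inr] at hg
  -- real part: a relation among the `log εᵢ`
  have hre := congrArg Complex.re hg
  simp only [Complex.add_re, Complex.re_sum, Complex.smul_re, Complex.ofReal_re,
    Complex.mul_re, Complex.I_re, Complex.I_im, Complex.ofReal_im, mul_zero, mul_one,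
    smul_zero, Finset.sum_const_zero, add_zero, Complex.zero_re, sub_self] at hre
  -- imaginary part: a relation among the `θ_k`
  have him := congrArg Complex.im hg
  simp only [Complex.add_im, Complex.im_sum, Complex.smul_im, Complex.ofReal_im,
    Complex.mul_im, Complex.I_re, Complex.I_im, Complex.ofReal_re, mul_zero, mul_one,
    zero_add, smul_zero, Finset.sum_const_zero, Complex.zero_im, add_zero] at him
  have h1 := Fintype.linearIndependent_iff.mp hli (fun i => g (Sum.inl i)) hre
  have h2 := Fintype.linearIndependent_iff.mp hliθ (fun k => g (Sum.inr k)) him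
  rintro (i | k)
  · exact h1 i
  · exact h2 k

/-! ## The certificate: Baker's theorem at the mixed family -/

/-- **Baker's certificate for real logarithms and angles.** For positive real algebraic
`ε₁, …, ε_s` with `ℚ`-linearly independent logarithms and `ℚ`-linearly independent real
`θ₁, …, θ_{s'}` with `e^{iθ_k}` algebraic, the finite family `1, log ε₁, …, log ε_s, iθ₁, …, iθ_{s'}`
of complex numbers is linearly independent over the field `ℚ̄ = algebraicClosure ℚ ℂ` of all
algebraic numbers (Baker's Theorem 2.1 at the logarithms `log εᵢ` and `iθ_k` of the algebraic
numbers `εᵢ`, `e^{iθ_k}`). [cite: Baker1975, Theorem 2.1] -/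
theorem linearIndependent_algebraicClosure_one_logs_angles {s s' : ℕ} (ε : Fin s → ℝ)
    (hε : ∀ i, 0 < ε i) (hεalg : ∀ i, IsAlgebraic ℚ (ε i))
    (hli : LinearIndependent ℚ (fun i => Real.log (ε i))) (θ : Fin s' → ℝ)
    (hθalg : ∀ k, IsAlgebraic ℚ (Complex.exp ((θ k : ℂ) * I))) (hliθ : LinearIndependent ℚ θ) :
    LinearIndependent (algebraicClosure ℚ ℂ)
      fun o : Option (Fin s ⊕ Fin s') => o.elim (1 : ℂ)
        (Sum.elim (fun i => ((Real.log (ε i) : ℝ) : ℂ)) (fun k => (θ k : ℂ) * I)) := by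
  refine Literature.NumberTheory.Transcendental.baker_holds _ ?_
    (linearIndependent_rat_logs_angles ε hli θ hliθ)
  rintro (i | k)
  · -- `e^{log εᵢ} = εᵢ` is algebraic
    rw [Sum.elim_inl, ← Complex.ofReal_exp, Real.exp_log (hε i)]
    exact (hεalg i).algebraMap
  · rw [Sum.elim_inr]
    exact hθalg k

/-! ## The registered sub-goal -/

/-- **Baker, mixed torsion-free form used by the arctangent layer** (registered sub-goal
`eq_zero_of_alg_logs_angles_eq_zero` of crux stmt-KontsevichZagierPeriods-3869). If
`ε₁, …, ε_s > 0` are real algebraic with `ℚ`-linearly independent logarithms, `θ₁, …, θ_{s'}` are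
`ℚ`-linearly independent reals with `e^{iθ_k}` algebraic, and
`r + Σᵢ Cᵢ log εᵢ + Σ_k D_k θ_k = 0` with real ALGEBRAIC `r, Cᵢ, D_k`, then `r = 0`, every `Cᵢ = 0`
and every `D_k = 0`: the relation, read in `ℂ` as `r • 1 + Σᵢ Cᵢ • log εᵢ + Σ_k (-i D_k) • (iθ_k) = 0`
with coefficients in `ℚ̄`, is a finite relation against Baker's certificate
(`linearIndependent_algebraicClosure_one_logs_angles`), so the finite core
(`eq_zero_of_linearIndependent_option_sum_elim`) kills every coefficient.
[cite: Baker1975, Theorem 2.1] -/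
theorem eq_zero_of_alg_logs_angles_eq_zero {s s' : ℕ} (ε : Fin s → ℝ) (hε : ∀ i, 0 < ε i)
    (hεalg : ∀ i, IsAlgebraic ℚ (ε i)) (hli : LinearIndependent ℚ (fun i => Real.log (ε i)))
    (θ : Fin s' → ℝ) (hθalg : ∀ k, IsAlgebraic ℚ (Complex.exp ((θ k : ℂ) * I)))
    (hliθ : LinearIndependent ℚ θ) (r : ℝ) (hr : IsAlgebraic ℚ r) (C : Fin s → ℝ)
    (hC : ∀ i, IsAlgebraic ℚ (C i)) (D : Fin s' → ℝ) (hD : ∀ k, IsAlgebraic ℚ (D k))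
    (h : r + ∑ i, C i * Real.log (ε i) + ∑ k, D k * θ k = 0) :
    r = 0 ∧ (∀ i, C i = 0) ∧ ∀ k, D k = 0 := by
  -- real algebraic numbers, complexified, are elements of `ℚ̄ ⊂ ℂ`
  have hmem : ∀ x : ℝ, IsAlgebraic ℚ x → (x : ℂ) ∈ algebraicClosure ℚ ℂ := fun x hx =>
    mem_algebraicClosure_iff.mpr hx.algebraMap
  -- `i ∈ ℚ̄` (a root of `X² + 1`), hence so is `-i D_k`
  have hI : I ∈ algebraicClosure ℚ ℂ := by
    refine mem_algebraicClosure_iff.mpr ⟨Polynomial.X ^ 2 + 1, ?_, ?_⟩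
    · exact (Polynomial.monic_X_pow_add_C (1 : ℚ) two_ne_zero).ne_zero
    · simp
  have hID : ∀ k, -I * (D k : ℂ) ∈ algebraicClosure ℚ ℂ := fun k =>
    mul_mem (neg_mem hI) (hmem (D k) (hD k))
  -- the relation, read in `ℂ`
  have hrel : (r : ℂ) * 1 + ∑ i, (C i : ℂ) * ((Real.log (ε i) : ℝ) : ℂ)
      + ∑ k, (-I * (D k : ℂ)) * ((θ k : ℂ) * I) = 0 := by
    have hk : ∀ k, (-I * (D k : ℂ)) * ((θ k : ℂ) * I) = ((D k * θ k : ℝ) : ℂ) := by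
      intro k
      push_cast
      linear_combination (-(D k : ℂ) * (θ k : ℂ)) * Complex.I_sq
    rw [mul_one, Fintype.sum_congr _ _ hk]
    exact_mod_cast congrArg (fun t : ℝ => (t : ℂ)) h
  -- decide on the finite core against Baker's certificate
  obtain ⟨hr0, hC0, hD0⟩ := eq_zero_of_linearIndependent_option_sum_elim
    (linearIndependent_algebraicClosure_one_logs_angles ε hε hεalg hli θ hθalg hliθ)
    (⟨(r : ℂ), hmem r hr⟩ : algebraicClosure ℚ ℂ) (fun i => ⟨(C i : ℂ), hmem (C i) (hC i)⟩)
    (fun k => ⟨-I * (D k : ℂ), hID k⟩) hrel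
  refine ⟨Complex.ofReal_eq_zero.mp (congrArg Subtype.val hr0),
    fun i => Complex.ofReal_eq_zero.mp (congrArg Subtype.val (hC0 i)), fun k => ?_⟩
  have hk : -I * (D k : ℂ) = 0 := congrArg Subtype.val (hD0 k)
  simpa [Complex.I_ne_zero] using hk

end Summit.KontsevichZagierPeriods.HurwitzMicroSectors.NormalFormPrinciple.PiBox.Ang.SiegeK4
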